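import Summits.ABC.ABC.Theses.IUTThetaPilot
import Summits.ABC.ABC.Theorems.IUTThetaPilotThetaPartIIStubThetaDataPrelims
import Summits.ABC.IUTFork.LDHGenuineTowerArithPinnedP
import Literature.IUT.LogVolume.GenuineRamificationBoundsPinned
import HarnessLib

/-!
# Crux `ThetaPartII` (route `IUTThetaPilot`, stmt-ABC-19678), layer-2 UNION skeleton 76b99b29aaa7c8f6:
# the registered stub `stub_hullVolumePerImage` (ii′-P) CLOSED

[IUTchIV] Thm. 1.10 proof Steps (ii)–(viii) (kurims Apr. 2020 pp. 24–31) in the per-image reading (P) of [IUTchIII]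
Cor. 3.12 proof Step (x) p. 181: for every `λ`-line point `P ∈ U_P`, prime `l ≥ 5` with `AdmitsCore`, (P2), (P5), (P6),
and EVERY genuine Θ-volume datum `T` at `(P, l)` (reading v3: `F_tpd ⊆ F ⊆ F‡`, `K = F(E_F[l])`, genuine completions),
the procession-normalised log-volume of the hull of ONE (Ind1)×(Ind2)-image of the Θ-pilot region exceeds
`−deĝ̲_lgp(P_Θ)` by at most the REGISTERED constant
`B_III(P,l) = (l+1)/4·{(1 + 12·d_mod/l)·(log-diff + log 𝔣^{∤{2,l}}) + 2·log l + 52 + (20/3)·log(d*·l)·π(d*·l)}`,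
`d* = 2^12·3^3·5·d_mod` — i.e. the registered stub

  `stub_hullVolumePerImage : ∀ P : NFPoint, P ∈ UP → ∀ l : ℕ, l.Prime → 5 ≤ l → Cor22.AdmitsCore P → Cor22.CondP2 P l →
     Cor22.CondP5 P l → Cor22.CondP6 P l → Cor22.HullVolumePerImageAtDatum P l (B_III P l)`

is PROVED, by composition BY NAME of the cell's kernel pieces: abc-iut-S7's per-image Step (v) constant
(`DHData.hullEstimatePerImageOf_ofInput_explicit`, every genuine input, no slot-constancy), abc-iut-S3's tower arithmetic
(`Cor22.deltaK_le_BIII_of_le21`, `sum_log_supportPrimes_le`) with abc-iut-S1's different sums and abc-iut-L5-t15's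
Step (ii) bounds, abc-iut-S-d1's `Cor22.ThetaVolumeDatumAt.towerFacts` ((α)(β) of the tower at every datum) — all via
abc-iut-S3's pinned per-image junction `PointDict.hullVolumePerImageAtDatum_BIII_pinned` (LDHGenuineTowerArithPinnedP;
the bundled twin `PointDict.hullVolumePerImageAtDatum_BIII_of_R4` of abc-iut-c312-d1's LDHGenuineTowerArithPerImage is the
same mathematics) — and abc-iut-S1's e-term
`Cor22.ThetaVolumeDatumAt.R4_towerFact` ((R4) for the genuine completions with print's `e*_mod` read as `d*_mod`, EVERY
datum, no hypothesis beyond `λ ∈ U_P`); `7 ≤ l` from (P6) (abc-iut-c312-8 `seven_le_of_condP6`). Classical throughout.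
TAKES NO SIDE on [IUTchIII] Cor. 3.12: this is the COMPUTABLE half (ii′-P) of the display-P line only; the crux content
(iii-P) `stub_cor312PerImage` (and (iii) `stub_cor312`) is the disputed claim and is NOT touched; reading (P) is one of the
two typed readings of "−|log(Θ)|" (VERDICT RISK 7). [cite: Mochizuki2012, IUTchIV Thm. 1.10 proof Steps (ii)–(viii)
p. 24–31] [cite: Mochizuki2012, IUTchIII Cor. 3.12 proof Step (x) p. 181] [claim: Mochizuki2012, status: disputed].
-/

noncomputable section

set_option linter.dupNamespace false

namespace Summit.ABC.ABC.Theorems.ThetaPartII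

open Literature.NumberTheory.DiophantineGeometry.GenEll Literature.IUT.LogVolume Literature.IUT.HodgeTheaters

/-- **`stub_hullVolumePerImage` of the union skeleton of crux `ThetaPartII` (exact registered header)**: for every
`λ`-line point `P ∈ U_P` and prime `l ≥ 5` with `AdmitsCore`, (P2), (P5), (P6), `Cor22.HullVolumePerImageAtDatum P l
(B_III P l)` — at every genuine Θ-volume datum the per-image hull log-volume exceeds `−deĝ̲_lgp(P_Θ)` by at most
`B_III(P, l)`. [cite: Mochizuki2012, IUTchIV Thm. 1.10 proof Steps (ii)–(viii) p. 24–31]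
[cite: Mochizuki2012, IUTchIII Cor. 3.12 proof Step (x) p. 181] -/
theorem stub_hullVolumePerImage : ∀ P : NFPoint, P ∈ UP → ∀ l : ℕ, l.Prime → 5 ≤ l → Cor22.AdmitsCore P →
    Cor22.CondP2 P l → Cor22.CondP5 P l → Cor22.CondP6 P l →
    Cor22.HullVolumePerImageAtDatum P l (((l : ℝ) + 1) / 4 * ((1 + 12 * (Cor22.dmod P : ℝ) / l)
      * (P.logDiff + Cor22.logCondAvoid P {2, l}) + 2 * Real.log l + 52
        + 20 / 3 * Real.log (((2 ^ 12 * 3 ^ 3 * 5 * Cor22.dmod P : ℕ) : ℝ) * (l : ℝ))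
          * (Nat.primeCounting (2 ^ 12 * 3 ^ 3 * 5 * Cor22.dmod P * l) : ℝ))) := by
  intro P hP l hl h5 _ _ _ h6
  exact Summit.ABC.IUTFork.PointDict.hullVolumePerImageAtDatum_BIII_pinned hP (seven_le_of_condP6 hP hl h5 h6)
    fun T => T.R4_towerFact hP

/-- The same, bundled over the stub's antecedent as a single implication at `(P, l)` (convenience form for the
compositions `ThetaPartII_of_perImage` / the degree-one rung). [cite: Mochizuki2012, IUTchIV Thm. 1.10 proof Steps (ii)–(viii) p. 24–31] -/
theorem hullVolumePerImageAtDatum_BIII {P : NFPoint} (hP : P ∈ UP) {l : ℕ} (hl : l.Prime) (h5 : 5 ≤ l)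
    (h6 : Cor22.CondP6 P l) :
    Cor22.HullVolumePerImageAtDatum P l (((l : ℝ) + 1) / 4 * ((1 + 12 * (Cor22.dmod P : ℝ) / l)
      * (P.logDiff + Cor22.logCondAvoid P {2, l}) + 2 * Real.log l + 52
        + 20 / 3 * Real.log (((2 ^ 12 * 3 ^ 3 * 5 * Cor22.dmod P : ℕ) : ℝ) * (l : ℝ))
          * (Nat.primeCounting (2 ^ 12 * 3 ^ 3 * 5 * Cor22.dmod P * l) : ℝ))) :=
  Summit.ABC.IUTFork.PointDict.hullVolumePerImageAtDatum_BIII_pinned hP (seven_le_of_condP6 hP hl h5 h6)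
    fun T => T.R4_towerFact hP

end Summit.ABC.ABC.Theorems.ThetaPartII

end
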